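import Mathlib
import Summits.AnomalousDissipation.AnomalousDissipation.Theorems.SoloBlindQuadraticResolventBound

/-!
# Structured Woodbury resolvent: the bridge assembly from the scalar loop (solo-blind kernel #176)

Paper `steady-zeroth-law.md` §24.104 / PLAN §103 (k).  The complement-with-loop propagation of the leaf chain is the
certified contracting complement `L` (block-cyclic system of `w_{i+1} = D_i w_i`, invertible because `1 - M_D` is)
plus the rank-structured feedback `V G` (injection `V` = the slaving datum, observation `G` = the row `g`).  The
Woodbury identity inverts `L + V G` through the SCALAR loop operator `S = 1 + G L⁻¹ V = 1 + 𝒦` — the object whose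
modulus envelope kernel #175 certifies — and the norm bound it yields is STRUCTURED:

  `‖(L + V G)⁻¹‖ ≤ ‖L⁻¹‖ + ‖L⁻¹ V‖ · ‖S⁻¹‖ · ‖G L⁻¹‖`,

with the controllability constant `‖L⁻¹ V‖` and the observability constant `‖G L⁻¹‖` in place of the lossy
`‖L⁻¹‖ ‖V‖` and `‖G‖ ‖L⁻¹‖` (`‖G‖ = O(P)` for the chain, while `G L⁻¹` is the structured `O(P^γ)`, `γ ≤ 1`, object
admitted by the plateau lemma).  Everything is stated in a normed ring (pad `V`, `G` to square matrices); no
commutativity is used.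

* `soloBlind_woodbury_inverse` — `(L + V G) (L⁻¹ - L⁻¹ V S⁻¹ G L⁻¹) = 1` and the same on the left;
* `soloBlind_woodbury_norm_le` — the structured norm bound;
* `soloBlind_loop_resolvent` — with `‖G L⁻¹ V‖ ≤ q < 1` (the certified loop size, e.g. the Schur mass of the
  envelope): `L + V G` is two-sidedly invertible with `‖(L + V G)⁻¹‖ ≤ ‖L⁻¹‖ + ‖L⁻¹ V‖ ‖G L⁻¹‖ / (1 - q)`.
-/

namespace Summit.AnomalousDissipation.AnomalousDissipation.Theorems

section

variable {R : Type*} [Ring R]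

/-- **Woodbury identity, two-sided, hypothesis form.**  If `Li` is a two-sided inverse of `L` and `Si` a two-sided
inverse of the loop operator `1 + G Li V`, then `Li - Li V Si G Li` is a two-sided inverse of `L + V G`. -/
theorem soloBlind_woodbury_inverse (L Li V G Si : R) (hL : L * Li = 1) (hL' : Li * L = 1)
    (hS : (1 + G * Li * V) * Si = 1) (hS' : Si * (1 + G * Li * V) = 1) :
    (L + V * G) * (Li - Li * V * Si * G * Li) = 1 ∧ (Li - Li * V * Si * G * Li) * (L + V * G) = 1 := by
  constructor
  · calc (L + V * G) * (Li - Li * V * Si * G * Li)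
          = L * Li + V * (G * Li) - (L * Li) * (V * Si * G * Li) - V * ((G * Li * V) * Si) * (G * Li) := by
            noncomm_ring
      _ = 1 + V * (G * Li) - V * (((1 : R) + G * Li * V) * Si) * (G * Li) := by rw [hL]; noncomm_ring
      _ = 1 := by rw [hS]; noncomm_ring
  · calc (Li - Li * V * Si * G * Li) * (L + V * G)
          = Li * L + (Li * V) * G - (Li * V) * Si * G * (Li * L) - (Li * V) * (Si * (G * Li * V)) * G := by
            noncomm_ring
      _ = 1 + (Li * V) * G - (Li * V) * (Si * ((1 : R) + G * Li * V)) * G := by rw [hL']; noncomm_ring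
      _ = 1 := by rw [hS']; noncomm_ring

end

section

variable {R : Type*} [NormedRing R]

/-- **Structured norm bound** for the Woodbury inverse: controllability `‖L⁻¹ V‖` and observability `‖G L⁻¹‖`
constants, not `‖V‖`, `‖G‖`. -/
theorem soloBlind_woodbury_norm_le (Li V G Si : R) :
    ‖Li - Li * V * Si * G * Li‖ ≤ ‖Li‖ + ‖Li * V‖ * ‖Si‖ * ‖G * Li‖ := by
  have h : Li * V * Si * G * Li = (Li * V) * Si * (G * Li) := by noncomm_ring
  rw [h]
  refine (norm_sub_le _ _).trans (add_le_add le_rfl ?_)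
  exact (norm_mul_le _ _).trans (mul_le_mul_of_nonneg_right (norm_mul_le _ _) (norm_nonneg _))

end

section

variable {R : Type*} [NormedRing R] [CompleteSpace R] [NormOneClass R]

/-- **Loop resolvent (bridge assembly).**  If `L` is two-sidedly invertible and the scalar loop `G L⁻¹ V` has norm
`≤ q < 1` (e.g. `q` = the Schur mass of a certified modulus envelope, kernel #175), then `L + V G` is two-sidedly
invertible and `‖(L + V G)⁻¹‖ ≤ ‖L⁻¹‖ + ‖L⁻¹ V‖ ‖G L⁻¹‖ / (1 - q)`. -/
theorem soloBlind_loop_resolvent (𝕜 : Type*) [NontriviallyNormedField 𝕜] [NormedAlgebra 𝕜 R]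
    (L Li V G : R) (q : ℝ) (hL : L * Li = 1) (hL' : Li * L = 1)
    (hq : ‖G * Li * V‖ ≤ q) (hq1 : q < 1) :
    ∃ X : R, (L + V * G) * X = 1 ∧ X * (L + V * G) = 1 ∧
      ‖X‖ ≤ ‖Li‖ + ‖Li * V‖ * ‖G * Li‖ / (1 - q) := by
  -- Neumann inverse of `1 + G Li V = (1 - 0) • 1 - (-(G Li V))`
  have hq' : ‖-(G * Li * V)‖ ≤ q := by rwa [norm_neg]
  have h1 : q < ‖(1 : 𝕜) - 0‖ := by simpa using hq1
  obtain ⟨Si, hS, hS', hSn⟩ := soloBlind_inverse_scalar_sub (𝕜 := 𝕜) (0 : 𝕜) (-(G * Li * V)) q hq' h1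
  have hE : ((1 : 𝕜) - 0) • (1 : R) - -(G * Li * V) = 1 + G * Li * V := by simp
  rw [hE] at hS hS'
  obtain ⟨h2, h3⟩ := soloBlind_woodbury_inverse L Li V G Si hL hL' hS hS'
  refine ⟨Li - Li * V * Si * G * Li, h2, h3, (soloBlind_woodbury_norm_le Li V G Si).trans ?_⟩
  have hSn' : ‖Si‖ ≤ 1 / (1 - q) := by simpa using hSn
  have h1q : 0 < 1 - q := by linarith
  have hcv : 0 ≤ ‖Li * V‖ * ‖G * Li‖ := mul_nonneg (norm_nonneg _) (norm_nonneg _)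
  calc ‖Li‖ + ‖Li * V‖ * ‖Si‖ * ‖G * Li‖ = ‖Li‖ + ‖Li * V‖ * ‖G * Li‖ * ‖Si‖ := by ring
    _ ≤ ‖Li‖ + ‖Li * V‖ * ‖G * Li‖ * (1 / (1 - q)) := by
        exact add_le_add le_rfl (mul_le_mul_of_nonneg_left hSn' hcv)
    _ = ‖Li‖ + ‖Li * V‖ * ‖G * Li‖ / (1 - q) := by rw [mul_one_div]

end

end Summit.AnomalousDissipation.AnomalousDissipation.Theorems
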